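import Literature.Algebra.Homology.RepExtGroupCohomologyNaturality
import Literature.Algebra.Homology.ExtOfProjectiveResolutionClasses
import HarnessLib

/-!
# `Extⁿ_{Rep k G}(k, A) ≃+ Hⁿ(Hom(P•, A))` on cocycle classes, and the short exact sequence of Hom
# complexes `Hom(P•, S)`

Topic `Algebra/Homology`; namespace `Literature.Algebra.Homology.RepExt` (plus two generic lemmas in
`Literature.Algebra.Homology.LeftResolution`).  One definition with body (`homSC`) and theorems; no
named fact, no instance, no `sorry`.  Sequel of `RepExtGroupCohomology` / `RepExtGroupCohomologyNaturality`
(the dictionary `extTrivialAddEquivResolutionHomology : Extⁿ(k, A) ≃+ Hⁿ(Hom(P•, A))`,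
`extTrivialAddEquivGroupCohomology`) and of `ExtOfProjectiveResolutionClasses` (explicit cocycle classes
of the first-variable engine, complexes of abelian groups).  This file moves those explicit classes to
Mathlib's `k`-module complexes `P.complex.linearYonedaObj k A` (where `groupCohomology` lives and where
Mathlib's concrete `δ_apply` is available):

* `LeftResolution.exists_iCycles_eq` (abstract cycles over cocycles of a complex of abelian groups),
  `LeftResolution.map_homologyπ_mapHomologyIso` (a homology-preserving functor versus `homologyπ`);
* `homSC P S` — `0 → Hom(P•, X₁) → Hom(P•, X₂) → Hom(P•, X₃) → 0` for a projective resolution `P` and a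
  short complex `S` of representations; `homSC_shortExact`;
* `homComplexHomologyIso_homologyπ`: `Hⁿ(Ext⁰(P•, A)) ≅ Hⁿ(Hom(P•, A))` maps classes of cycles to classes
  of cycles over the same cochain;
* **`extTrivialAddEquivResolutionHomology_symm_homologyπ(_zero)`**: under `Extⁿ(k, A) ≃+ Hⁿ(Hom(P•, A))`
  the class of the cocycle `p_{Qₙ} ≫ ē` (`Qₙ = coker(Pₙ₊₁ → Pₙ)`, `ē : Qₙ ⟶ A`) is the spliced Yoneda
  class `ι⁻¹ ∘ Δₙ₋₁([0 → Qₙ → Pₙ₋₁ → Qₙ₋₁ → 0] ∘ ē)` (`ι : Q₀ ≅ k`), resp. `ι⁻¹ ∘ ē` in degree `0`.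

Written for Route A of crux `stmt-BirchSwinnertonDyer-19295` (cell `bsd-schneider-ideate`, seat
door-c4 gen 14): input of `RepExtGroupCohomologyDelta` (the dictionary commutes with connecting
homomorphisms) and of the change-of-group compatibility.  HONEST FRAMING: homological algebra only.

## References
* C. A. Weibel, *An introduction to homological algebra* (1994), §1.3, §2.4 (Exercise 2.4.3),
  Theorem 2.7.6. [Weibel1994]
* K. S. Brown, *Cohomology of Groups*, GTM 87 (1982), III §1, III (6.1). [Brown1982CohomologyGroups]
-/

noncomputable section

universe w v u

namespace Literature.Algebra.Homology

/-! ## §0 Two generic lemmas -/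

namespace LeftResolution

open CategoryTheory CategoryTheory.Limits CategoryTheory.Abelian

/-- In a cochain complex of abelian groups every element killed by `d` underlies an abstract cycle.
[cite: Weibel1994, §1.3] -/
theorem exists_iCycles_eq (K : CochainComplex AddCommGrpCat.{w} ℕ) (j : ℕ) (x : K.X j)
    (hx : (K.d j (j + 1)).hom x = 0) : ∃ cyc : K.cycles j, (K.iCycles j).hom cyc = x := by
  have hx' : (K.sc j).g.hom x = 0 := by
    change (K.d j ((ComplexShape.up ℕ).next j)).hom x = 0
    rw [CochainComplex.next]
    exact hx
  exact ⟨(K.sc j).abCyclesIso.inv.hom ⟨x, hx'⟩, (K.sc j).abCyclesIso_inv_apply_iCycles ⟨x, hx'⟩⟩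

/-- **A functor preserving homology versus `homologyπ`**:
`(S.map F).homologyπ ≫ mapHomologyIso = mapCyclesIso ≫ F.map S.homologyπ`. [cite: Weibel1994, §1.3] -/
theorem map_homologyπ_mapHomologyIso {C : Type u} [Category.{v} C] {D : Type*} [Category D]
    [HasZeroMorphisms C] [HasZeroMorphisms D] (S : ShortComplex C) (F : C ⥤ D)
    [F.PreservesZeroMorphisms] [S.HasHomology] [(S.map F).HasHomology] [F.PreservesLeftHomologyOf S] :
    (S.map F).homologyπ ≫ (S.mapHomologyIso F).hom =
      (S.mapCyclesIso F).hom ≫ F.map S.homologyπ := by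
  have key : F.map S.leftHomologyData.π ≫ F.map S.leftHomologyData.homologyIso.inv =
      F.map S.leftHomologyData.cyclesIso.inv ≫ F.map S.homologyπ := by
    rw [← F.map_comp, ← F.map_comp, ShortComplex.LeftHomologyData.π_comp_homologyIso_inv]
  rw [S.leftHomologyData.mapHomologyIso_eq F, S.leftHomologyData.mapCyclesIso_eq F, Iso.trans_hom,
    Iso.trans_hom, ShortComplex.LeftHomologyData.homologyπ_comp_homologyIso_hom_assoc,
    Functor.mapIso_hom, Functor.mapIso_hom, Iso.symm_hom, Iso.symm_hom, Category.assoc]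
  exact congrArg (fun t : F.obj S.leftHomologyData.K ⟶ F.obj S.homology =>
    (S.leftHomologyData.map F).cyclesIso.hom ≫ t) key

end LeftResolution

namespace RepExt

open CategoryTheory CategoryTheory.Limits CategoryTheory.Abelian

variable {k G : Type u} [CommRing k] [Group G]

/-! ## §1 The short exact sequence of Hom complexes `Hom(P•, S)` -/

section HomSC

variable (P : ProjectiveResolution (Rep.trivial k G k)) (S : ShortComplex (Rep.{u} k G))

/-- **`0 → Hom(P•, X₁) → Hom(P•, X₂) → Hom(P•, X₃) → 0`** (cochain complexes of `k`-modules,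
postcomposition). [cite: Brown1982CohomologyGroups, III (6.1)] -/
def homSC : ShortComplex (CochainComplex (ModuleCat.{u} k) ℕ) :=
  ShortComplex.mk (ResolutionComparison.postcomp P.complex S.f)
    (ResolutionComparison.postcomp P.complex S.g) (by
      ext n : 1
      rw [HomologicalComplex.comp_f, HomologicalComplex.zero_f]
      refine ModuleCat.hom_ext (LinearMap.ext fun g => ?_)
      change ((g ≫ S.f) ≫ S.g : P.complex.X n ⟶ S.X₃) = 0
      rw [Category.assoc, S.zero, comp_zero])

variable {S}

/-- It is short exact (the `Pₙ` are projective). [cite: Brown1982CohomologyGroups, III (6.1)] -/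
theorem homSC_shortExact (hS : S.ShortExact) : (homSC P S).ShortExact := by
  haveI := hS.mono_f
  haveI := hS.epi_g
  refine HomologicalComplex.shortExact_of_degreewise_shortExact _ fun n => ?_
  refine ShortComplex.ShortExact.mk' ?_ ?_ ?_
  · rw [ShortComplex.moduleCat_exact_iff]
    intro (g : P.complex.X n ⟶ S.X₂) (hg : (g ≫ S.g : P.complex.X n ⟶ S.X₃) = 0)
    exact ⟨hS.exact.lift g hg, hS.exact.lift_f g hg⟩
  · rw [ModuleCat.mono_iff_injective]
    intro (g₁ : P.complex.X n ⟶ S.X₁) (g₂ : P.complex.X n ⟶ S.X₁)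
      (h : (g₁ ≫ S.f : P.complex.X n ⟶ S.X₂) = g₂ ≫ S.f)
    exact (cancel_mono S.f).1 h
  · rw [ModuleCat.epi_iff_surjective]
    intro (g : P.complex.X n ⟶ S.X₃)
    exact ⟨Projective.factorThru g S.g, Projective.factorThru_comp g S.g⟩

end HomSC

/-! ## §2 The dictionary on cocycle classes -/

section Classes

variable (P : ProjectiveResolution (Rep.trivial k G k)) (A : Rep.{u} k G)

/-- Unfolding in positive degrees. [cite: Weibel1994, Theorem 2.7.6] -/
theorem extTrivialAddEquivHomComplexHomology_succ (n : ℕ) :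
    extTrivialAddEquivHomComplexHomology P A (n + 1) =
      haveI := epi_aug P
      LeftResolution.extAddEquivHomologySucc P.complex A (aug P) (d_comp_aug P) (exact_aug P)
        P.complex_exactAt_succ (LeftResolution.ext_eq_zero_of_projective P.complex A P.projective) n :=
  rfl

/-- Unfolding in degree `0`. [cite: Weibel1994, Theorem 2.7.6] -/
theorem extTrivialAddEquivHomComplexHomology_zero :
    extTrivialAddEquivHomComplexHomology P A 0 =
      haveI := epi_aug P
      LeftResolution.extAddEquivHomologyZero P.complex A (aug P) (d_comp_aug P) (exact_aug P) :=
  rfl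

/-- **`Hⁿ(Ext⁰(P•, A)) ≅ Hⁿ(Hom(P•, A))` on classes of cycles**: the class of an abstract cycle of
`Ext⁰(P•, A)` goes to the class of any cycle of `Hom(P•, A)` over the same cochain (through
`Ext.addEquiv₀`). [cite: Weibel1994, Theorem 2.7.6] -/
theorem homComplexHomologyIso_homologyπ (n : ℕ) (cyc : (LeftResolution.homComplex P.complex A).cycles n)
    (cyc' : (P.complex.linearYonedaObj k A).cycles n)
    (h : (P.complex.linearYonedaObj k A).iCycles n cyc' =
      Ext.addEquiv₀ (((LeftResolution.homComplex P.complex A).iCycles n).hom cyc)) :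
    (homComplexHomologyIso P.complex A n).hom.hom
        (((LeftResolution.homComplex P.complex A).homologyπ n).hom cyc) =
      (P.complex.linearYonedaObj k A).homologyπ n cyc' := by
  -- step 1: across the isomorphism of complexes `homComplexIso`
  have h1 : (HomologicalComplex.homologyMap (homComplexIso P.complex A).hom n).hom
      (((LeftResolution.homComplex P.complex A).homologyπ n).hom cyc) =
      ((((forgetAb k).mapHomologicalComplex (ComplexShape.up ℕ)).obj
        (P.complex.linearYonedaObj k A)).homologyπ n).hom
        ((HomologicalComplex.cyclesMap (homComplexIso P.complex A).hom n).hom cyc) := by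
    change ((LeftResolution.homComplex P.complex A).homologyπ n ≫
      HomologicalComplex.homologyMap (homComplexIso P.complex A).hom n).hom cyc = _
    rw [HomologicalComplex.homologyπ_naturality]
    rfl
  -- step 2: across the forgetful functor
  have h2 := LeftResolution.map_homologyπ_mapHomologyIso ((P.complex.linearYonedaObj k A).sc n)
    (forgetAb k)
  -- the cycle on the `ModuleCat` side
  have h3 : (((P.complex.linearYonedaObj k A).sc n).mapCyclesIso (forgetAb k)).hom.hom
      ((HomologicalComplex.cyclesMap (homComplexIso P.complex A).hom n).hom cyc) = cyc' := by
    apply (ModuleCat.mono_iff_injective ((P.complex.linearYonedaObj k A).iCycles n)).1 inferInstance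
    refine Eq.trans ?_ h.symm
    have e1 := ShortComplex.mapCyclesIso_hom_iCycles ((P.complex.linearYonedaObj k A).sc n) (forgetAb k)
    have e2 := HomologicalComplex.cyclesMap_i (homComplexIso P.complex A).hom n
    change ((((P.complex.linearYonedaObj k A).sc n).mapCyclesIso (forgetAb k)).hom ≫
      (forgetAb k).map ((P.complex.linearYonedaObj k A).sc n).iCycles).hom
        ((HomologicalComplex.cyclesMap (homComplexIso P.complex A).hom n).hom cyc) = _
    rw [e1]
    change (HomologicalComplex.cyclesMap (homComplexIso P.complex A).hom n ≫
      (((forgetAb k).mapHomologicalComplex (ComplexShape.up ℕ)).obj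
        (P.complex.linearYonedaObj k A)).iCycles n).hom cyc = _
    rw [e2]
    rfl
  change (HomologicalComplex.homologyMap (homComplexIso P.complex A).hom n ≫
    (((P.complex.linearYonedaObj k A).sc n).mapHomologyIso (forgetAb k)).hom).hom
      (((LeftResolution.homComplex P.complex A).homologyπ n).hom cyc) = _
  change (((P.complex.linearYonedaObj k A).sc n).mapHomologyIso (forgetAb k)).hom.hom
    ((HomologicalComplex.homologyMap (homComplexIso P.complex A).hom n).hom _) = _
  rw [h1]
  change ((((P.complex.linearYonedaObj k A).sc n).map (forgetAb k)).homologyπ ≫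
    (((P.complex.linearYonedaObj k A).sc n).mapHomologyIso (forgetAb k)).hom).hom
      ((HomologicalComplex.cyclesMap (homComplexIso P.complex A).hom n).hom cyc) = _
  rw [h2]
  change ((forgetAb k).map ((P.complex.linearYonedaObj k A).homologyπ n)).hom
    ((((P.complex.linearYonedaObj k A).sc n).mapCyclesIso (forgetAb k)).hom.hom _) = _
  rw [h3]
  rfl

/-- **Positive degrees: under `Extⁿ⁺¹(k, A) ≃+ Hⁿ⁺¹(Hom(P•, A))` the class of the cocycle
`p_{Qₙ₊₁} ≫ ē` is `ι⁻¹ ∘ Δₙ([0 → Qₙ₊₁ → Pₙ → Qₙ → 0] ∘ ē)`.** [cite: Weibel1994, §2.4 (Exercise 2.4.3), Theorem 2.7.6] -/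
theorem extTrivialAddEquivResolutionHomology_symm_homologyπ (n : ℕ)
    (ē : P.complex.opcycles (n + 1) ⟶ A) (cyc' : (P.complex.linearYonedaObj k A).cycles (n + 1))
    (h : (P.complex.linearYonedaObj k A).iCycles (n + 1) cyc' =
      (P.complex.pOpcycles (n + 1) ≫ ē : P.complex.X (n + 1) ⟶ A)) :
    haveI := epi_aug P
    (extTrivialAddEquivResolutionHomology P A (n + 1)).symm
        ((P.complex.linearYonedaObj k A).homologyπ (n + 1) cyc') =
      (Ext.mk₀ (LeftResolution.isoOpcyclesZero P.complex (aug P) (d_comp_aug P) (exact_aug P)).inv).comp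
        (LeftResolution.iterShift P.complex A P.complex_exactAt_succ
          (LeftResolution.ext_eq_zero_of_projective P.complex A P.projective) n (a := 0) (b := n + 1)
          (by omega)
          ((LeftResolution.opcyclesSC_shortExact P.complex n (P.complex_exactAt_succ n)).extClass.comp
            (Ext.mk₀ ē) (add_zero 1))) (zero_add (n + 1)) := by
  haveI := epi_aug P
  -- an abstract cycle of `Ext⁰(P•, A)` over `mk₀ (p ≫ ē)`
  obtain ⟨cyc, hcyc⟩ := LeftResolution.exists_iCycles_eq (LeftResolution.homComplex P.complex A) (n + 1)
    ((Ext.mk₀ (P.complex.pOpcycles (n + 1))).comp (Ext.mk₀ ē) (zero_add 0)) (by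
      rw [LeftResolution.homComplex_d_apply, Ext.mk₀_comp_mk₀, Ext.mk₀_comp_mk₀,
        HomologicalComplex.d_pOpcycles_assoc, zero_comp, Ext.mk₀_zero]
      rfl)
  have hE := LeftResolution.extAddEquivHomologySucc_symm_homologyπ P.complex A (aug P) (d_comp_aug P)
    (exact_aug P) P.complex_exactAt_succ (LeftResolution.ext_eq_zero_of_projective P.complex A P.projective)
    n (Ext.mk₀ ē) cyc hcyc
  have hπ := homComplexHomologyIso_homologyπ P A (n + 1) cyc cyc' (by
    rw [h, hcyc, Ext.mk₀_comp_mk₀, ← Ext.addEquiv₀_symm_apply, AddEquiv.apply_symm_apply])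
  have hπ' : (homComplexHomologyIso P.complex A (n + 1)).addCommGroupIsoToAddEquiv.symm
      ((P.complex.linearYonedaObj k A).homologyπ (n + 1) cyc') =
      ((LeftResolution.homComplex P.complex A).homologyπ (n + 1)).hom cyc := by
    rw [AddEquiv.symm_apply_eq]
    exact hπ.symm
  change (extTrivialAddEquivHomComplexHomology P A (n + 1)).symm
    ((homComplexHomologyIso P.complex A (n + 1)).addCommGroupIsoToAddEquiv.symm _) = _
  rw [hπ', extTrivialAddEquivHomComplexHomology_succ]
  exact hE

/-- **Degree `0`: under `Ext⁰(k, A) ≃+ H⁰(Hom(P•, A))` the class of the cocycle `p_{Q₀} ≫ ē` is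
`ι⁻¹ ∘ ē`.** [cite: Weibel1994, §2.4 (Exercise 2.4.3), Theorem 2.7.6] -/
theorem extTrivialAddEquivResolutionHomology_symm_homologyπ_zero
    (ē : P.complex.opcycles 0 ⟶ A) (cyc' : (P.complex.linearYonedaObj k A).cycles 0)
    (h : (P.complex.linearYonedaObj k A).iCycles 0 cyc' =
      (P.complex.pOpcycles 0 ≫ ē : P.complex.X 0 ⟶ A)) :
    haveI := epi_aug P
    (extTrivialAddEquivResolutionHomology P A 0).symm
        ((P.complex.linearYonedaObj k A).homologyπ 0 cyc') =
      (Ext.mk₀ (LeftResolution.isoOpcyclesZero P.complex (aug P) (d_comp_aug P) (exact_aug P)).inv).comp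
        (Ext.mk₀ ē) (zero_add 0) := by
  haveI := epi_aug P
  obtain ⟨cyc, hcyc⟩ := LeftResolution.exists_iCycles_eq (LeftResolution.homComplex P.complex A) 0
    ((Ext.mk₀ (P.complex.pOpcycles 0)).comp (Ext.mk₀ ē) (zero_add 0)) (by
      rw [LeftResolution.homComplex_d_apply, Ext.mk₀_comp_mk₀, Ext.mk₀_comp_mk₀,
        HomologicalComplex.d_pOpcycles_assoc, zero_comp, Ext.mk₀_zero]
      rfl)
  have hE := LeftResolution.extAddEquivHomologyZero_symm_homologyπ P.complex A (aug P) (d_comp_aug P)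
    (exact_aug P) (Ext.mk₀ ē) cyc hcyc
  have hπ := homComplexHomologyIso_homologyπ P A 0 cyc cyc' (by
    rw [h, hcyc, Ext.mk₀_comp_mk₀, ← Ext.addEquiv₀_symm_apply, AddEquiv.apply_symm_apply])
  have hπ' : (homComplexHomologyIso P.complex A 0).addCommGroupIsoToAddEquiv.symm
      ((P.complex.linearYonedaObj k A).homologyπ 0 cyc') =
      ((LeftResolution.homComplex P.complex A).homologyπ 0).hom cyc := by
    rw [AddEquiv.symm_apply_eq]
    exact hπ.symm
  change (extTrivialAddEquivHomComplexHomology P A 0).symm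
    ((homComplexHomologyIso P.complex A 0).addCommGroupIsoToAddEquiv.symm _) = _
  rw [hπ', extTrivialAddEquivHomComplexHomology_zero]
  exact hE

end Classes

end RepExt

end Literature.Algebra.Homology
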